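import Mathlib
import Literature.Probability.LatticeModels.DiscreteParseval
import Literature.Barriers.CriticalPhenomena.LaceExpansionIsingGreenUniform
import Literature.Barriers.CriticalPhenomena.LaceExpansionIsingGreenComparisonSymbols
import Literature.Barriers.CriticalPhenomena.LongRangeTrivialityOnZ3InfraredBound
import HarnessLib

/-!
# Character sums over boxes and the symbol lower bound `ψ(k) ≥ c‖k‖^α`

Helper file for item `stmt-CriticalPhenomena-4804`
(`Summit.CriticalPhenomena.Ising3DConformalLimit.Theses.PrecisionLaplacian.EtaBoundsTransfer`), part of its
unconditional proof. The Dirichlet kernel `D_L(t) = ∑_{m=-L}^{L} cos(m t)` and its bounds are taken from the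
Literature (`Literature.Barriers.CriticalPhenomena.SpreadOutIsing.dirichletRowSum`, `abs_dirichletRowSum_le`,
`abs_dirichletRowSum_mul_abs_sin_le`, `sum_box_cexp_kdot`, `sum_box_cos_kdot`, `abs_div_pi_le_abs_sin_half`;
`LongRangeIsing.exists_abs_eq_norm`); note `phase d k y = kdot k y` definitionally. New here: the decay
`|D_L(t)| ≤ π/|t|`, the sine sum over boxes, the block weight `∑_{y,y'∈Λ_L} cos(k·(y−y')) = (∏ D_L(k_j))²`
with its product bound, the counting estimate `∑_{Λ_L}(1 − cos k·y) ≥ L^d` for `L ≥ π/‖k‖`, and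
`psi_lower`. No definitions are introduced.
-/

namespace Summit.CriticalPhenomena.Ising3DConformalLimit.Theorems.EtaBoundsTransfer

open Finset Real Literature.Probability.LatticeModels
open Literature.Barriers.CriticalPhenomena Literature.Barriers.CriticalPhenomena.SpreadOutIsing
open scoped BigOperators

section Trig

/-! ### The Dirichlet kernel `D_L(t) = ∑_{m=-L}^{L} cos(m t)` (`dirichletRowSum`, Literature) -/

/-- **Dirichlet kernel decay**: `|D_L(t)| ≤ π / |t|` for `0 < |t| ≤ π` (from the Literature
bounds `|D_L(t)| |sin(t/2)| ≤ 1` and Jordan's `|sin(t/2)| ≥ |t|/π`). -/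
theorem abs_dirichletRowSum_le_pi_div (L : ℕ) {t : ℝ} (ht0 : t ≠ 0) (ht : |t| ≤ π) :
    |dirichletRowSum L t| ≤ π / |t| := by
  have hπ := Real.pi_pos
  have hpos : 0 < |t| / π := by positivity
  have hj := SpreadOutIsing.abs_div_pi_le_abs_sin_half ht
  have hsin : 0 < |Real.sin (t / 2)| := lt_of_lt_of_le hpos hj
  have hkey := abs_dirichletRowSum_mul_abs_sin_le L t
  calc |dirichletRowSum L t| ≤ 1 / |Real.sin (t / 2)| := by
        rw [le_div_iff₀ hsin]; exact hkey
    _ ≤ 1 / (|t| / π) := one_div_le_one_div_of_le hpos hj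
    _ = π / |t| := by field_simp

/-! ### Character sums over boxes (`phase d k y = kdot k y` definitionally) -/

variable {d : ℕ}

/-- The complex character sum over a box factorises into Dirichlet kernels:
`∑_{y ∈ Λ_L} e^{i k·y} = ∏_j D_L(k_j)` (the Literature lemma `sum_box_cexp_kdot`, restated for
`phase`). -/
theorem sum_box_cexp_phase (L : ℕ) (k : Fin d → ℝ) :
    ∑ y ∈ box d L, Complex.exp ((phase d k y : ℝ) * Complex.I)
      = ∏ j : Fin d, (dirichletRowSum L (k j) : ℂ) :=
  sum_box_cexp_kdot L k

/-- **Cosine sum over a box** `= ∏_j D_L(k_j)` (the Literature lemma `sum_box_cos_kdot`). -/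
theorem sum_box_cos_phase (L : ℕ) (k : Fin d → ℝ) :
    ∑ y ∈ box d L, Real.cos (phase d k y) = ∏ j : Fin d, dirichletRowSum L (k j) :=
  sum_box_cos_kdot L k

/-- **Sine sum over a box vanishes** (imaginary part of `sum_box_cexp_kdot`). -/
theorem sum_box_sin_phase (L : ℕ) (k : Fin d → ℝ) :
    ∑ y ∈ box d L, Real.sin (phase d k y) = 0 := by
  have h := congrArg Complex.im (sum_box_cexp_phase L k)
  rw [Complex.im_sum, ← Complex.ofReal_prod, Complex.ofReal_im] at h
  simp_rw [Complex.exp_ofReal_mul_I_im] at h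
  exact h

/-- `(∑ cos θ)^2 + (∑ sin θ)^2 = ∑∑ cos(θ_y − θ_{y'})` for a finite family of angles. -/
theorem sq_sum_cos_add_sq_sum_sin {ι : Type*} (s : Finset ι) (θ : ι → ℝ) :
    (∑ y ∈ s, Real.cos (θ y)) ^ 2 + (∑ y ∈ s, Real.sin (θ y)) ^ 2
      = ∑ y ∈ s, ∑ y' ∈ s, Real.cos (θ y - θ y') := by
  simp_rw [Real.cos_sub]
  rw [sq, sq, Finset.sum_mul_sum, Finset.sum_mul_sum, ← Finset.sum_add_distrib]
  refine Finset.sum_congr rfl fun y _ => ?_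
  rw [← Finset.sum_add_distrib]

/-- **The block weight of a box is a perfect square of Dirichlet kernels**:
`∑_{y,y' ∈ Λ_L} cos(k·(y − y')) = (∏_j D_L(k_j))²`. -/
theorem sum_box_box_cos_phase_sub (L : ℕ) (k : Fin d → ℝ) :
    ∑ y ∈ box d L, ∑ y' ∈ box d L, Real.cos (phase d k (y - y'))
      = (∏ j : Fin d, dirichletRowSum L (k j)) ^ 2 := by
  simp_rw [phase_sub]
  rw [← sq_sum_cos_add_sq_sum_sin, sum_box_cos_phase, sum_box_sin_phase]
  ring

/-- The block weight is nonnegative. -/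
theorem sum_box_box_cos_phase_sub_nonneg (L : ℕ) (k : Fin d → ℝ) :
    0 ≤ ∑ y ∈ box d L, ∑ y' ∈ box d L, Real.cos (phase d k (y - y')) := by
  rw [sum_box_box_cos_phase_sub]; positivity

/-- **Bound on the block weight**: `∑_{y,y' ∈ Λ_L} cos(k·(y − y')) ≤ ∏_j min(2L+1, π/|k_j|)²`
for `k ∈ [-π,π]^d` with all `k_j ≠ 0`. -/
theorem sum_box_box_cos_phase_sub_le (L : ℕ) {k : Fin d → ℝ} (hk : ∀ j, |k j| ≤ π)
    (hk0 : ∀ j, k j ≠ 0) :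
    ∑ y ∈ box d L, ∑ y' ∈ box d L, Real.cos (phase d k (y - y'))
      ≤ ∏ j : Fin d, (min (2 * L + 1 : ℝ) (π / |k j|)) ^ 2 := by
  rw [sum_box_box_cos_phase_sub, ← Finset.prod_pow]
  refine Finset.prod_le_prod (fun j _ => sq_nonneg _) fun j _ => ?_
  rw [← sq_abs]
  refine pow_le_pow_left₀ (abs_nonneg _) (le_min ?_ ?_) 2
  · exact abs_dirichletRowSum_le L (k j)
  · exact abs_dirichletRowSum_le_pi_div L (hk0 j) (hk j)

end Trig

section Psi

variable {d : ℕ}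

/-- **Counting estimate**: for `k ∈ [-π,π]^d ∖ 0` and `L ≥ π/‖k‖`,
`∑_{y ∈ Λ_L} (1 − cos(k·y)) ≥ L^d` (the character sum over the box is at most
`(2L+1)^{d-1} π/‖k‖ ≤ (2L+1)^{d-1} L`). -/
theorem sum_box_one_sub_cos_ge (hd : 1 ≤ d) {k : Fin d → ℝ} (hk : ‖k‖ ≤ π) (hk0 : k ≠ 0)
    {L : ℕ} (hL : π / ‖k‖ ≤ L) :
    (L : ℝ) ^ d ≤ ∑ y ∈ box d L, (1 - Real.cos (phase d k y)) := by
  have hnk : 0 < ‖k‖ := norm_pos_iff.2 hk0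
  obtain ⟨j₀, hj₀⟩ := LongRangeIsing.exists_abs_eq_norm hd k
  have hkj : ∀ j, |k j| ≤ π := fun j => by
    have := norm_le_pi_norm k j; rw [Real.norm_eq_abs] at this; exact this.trans hk
  have hkj₀ : k j₀ ≠ 0 := by
    intro h; rw [h, abs_zero] at hj₀; exact hnk.ne' hj₀.symm
  rw [Finset.sum_sub_distrib, Finset.sum_const, card_box, nsmul_eq_mul, mul_one,
    sum_box_cos_phase]
  push_cast
  -- bound the product of Dirichlet kernels
  have hprod : ∏ j : Fin d, dirichletRowSum L (k j) ≤ (2 * L + 1 : ℝ) ^ (d - 1) * (π / ‖k‖) := by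
    refine le_trans (le_abs_self _) ?_
    rw [Finset.abs_prod, ← Finset.prod_erase_mul _ _ (Finset.mem_univ j₀)]
    have h1 : ∏ j ∈ Finset.univ.erase j₀, |dirichletRowSum L (k j)| ≤ (2 * L + 1 : ℝ) ^ (d - 1) := by
      calc ∏ j ∈ Finset.univ.erase j₀, |dirichletRowSum L (k j)|
          ≤ ∏ j ∈ Finset.univ.erase j₀, (2 * L + 1 : ℝ) :=
            Finset.prod_le_prod (fun j _ => abs_nonneg _) fun j _ => abs_dirichletRowSum_le L (k j)
        _ = (2 * L + 1 : ℝ) ^ (d - 1) := by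
            rw [Finset.prod_const, Finset.card_erase_of_mem (Finset.mem_univ j₀),
              Finset.card_univ, Fintype.card_fin]
    have h2 : |dirichletRowSum L (k j₀)| ≤ π / ‖k‖ := by
      rw [← hj₀]; exact abs_dirichletRowSum_le_pi_div L hkj₀ (hkj j₀)
    exact mul_le_mul h1 h2 (abs_nonneg _) (by positivity)
  -- `(2L+1)^d - (2L+1)^{d-1} π/‖k‖ ≥ (2L+1)^{d-1} (L+1) ≥ L^d`
  have hL0 : (0 : ℝ) ≤ L := Nat.cast_nonneg L
  have hd1 : d = (d - 1) + 1 := (Nat.sub_add_cancel hd).symm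
  have hpow : (2 * L + 1 : ℝ) ^ d = (2 * L + 1 : ℝ) ^ (d - 1) * (2 * L + 1) := by
    conv_lhs => rw [hd1]
    rw [pow_succ]
  rw [hpow]
  have h3 : (L : ℝ) ^ d ≤ (2 * L + 1 : ℝ) ^ (d - 1) * ((2 * L + 1) - π / ‖k‖) := by
    calc (L : ℝ) ^ d = (L : ℝ) ^ (d - 1) * L := by
          conv_lhs => rw [hd1]
          rw [pow_succ]
      _ ≤ (2 * L + 1 : ℝ) ^ (d - 1) * ((2 * L + 1) - π / ‖k‖) := by
          apply mul_le_mul (pow_le_pow_left₀ hL0 (by linarith) _) (by linarith)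
            hL0 (by positivity)
  nlinarith [h3, hprod, pow_nonneg (show (0:ℝ) ≤ 2 * L + 1 by positivity) (d - 1)]

/-- **Lower bound on the symbol** `ψ(k) = ∑_y b(y)(1 − cos(k·y)) ≥ c (2π)^{-α} ‖k‖^α` on
`[-π,π]^d ∖ 0`, when `b(y) ≥ c ‖y‖^{-(d+α)}` off the origin. -/
theorem psi_lower (hd : 1 ≤ d) {b : Site d → ℝ} {c α : ℝ} (hc : 0 < c) (hα : 0 < α)
    (hb0 : ∀ y, 0 ≤ b y) (hbs : Summable b)
    (hlow : ∀ y, y ≠ 0 → c * ‖y‖ ^ (-((d : ℝ) + α)) ≤ b y)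
    {k : Fin d → ℝ} (hk : ‖k‖ ≤ π) (hk0 : k ≠ 0) :
    c * (2 * π) ^ (-α) * ‖k‖ ^ α ≤ ∑' y, b y * (1 - Real.cos (phase d k y)) := by
  have hπ := Real.pi_pos
  have hnk : 0 < ‖k‖ := norm_pos_iff.2 hk0
  have hge1 : 1 ≤ π / ‖k‖ := by rw [le_div_iff₀ hnk]; linarith
  set L : ℕ := ⌈π / ‖k‖⌉₊ with hLdef
  have hLge : π / ‖k‖ ≤ L := Nat.le_ceil _
  have hLpos : (0 : ℝ) < L := lt_of_lt_of_le (by positivity) hLge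
  have hLle : (L : ℝ) ≤ 2 * π / ‖k‖ := by
    have h1 : (L : ℝ) < π / ‖k‖ + 1 := Nat.ceil_lt_add_one (by positivity)
    have h2 : π / ‖k‖ + 1 ≤ 2 * π / ‖k‖ := by rw [two_mul, add_div]; linarith
    linarith
  -- summability of the symbol series and restriction to the box
  have hnn : ∀ y, 0 ≤ b y * (1 - Real.cos (phase d k y)) :=
    fun y => mul_nonneg (hb0 y) (by linarith [Real.cos_le_one (phase d k y)])
  have hsum : Summable (fun y => b y * (1 - Real.cos (phase d k y))) :=
    Summable.of_nonneg_of_le hnn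
      (fun y => mul_le_mul_of_nonneg_left (by linarith [Real.neg_one_le_cos (phase d k y)]) (hb0 y))
      (hbs.mul_right 2)
  have hstep1 : ∑ y ∈ box d L, b y * (1 - Real.cos (phase d k y))
      ≤ ∑' y, b y * (1 - Real.cos (phase d k y)) :=
    hsum.sum_le_tsum (box d L) (fun y _ => hnn y)
  -- pointwise lower bound on the box
  have hstep2 : ∑ y ∈ box d L, c * (L : ℝ) ^ (-((d : ℝ) + α)) * (1 - Real.cos (phase d k y))
      ≤ ∑ y ∈ box d L, b y * (1 - Real.cos (phase d k y)) := by
    apply Finset.sum_le_sum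
    intro y hy
    by_cases hy0 : y = 0
    · subst hy0; simp [phase]
    · apply mul_le_mul_of_nonneg_right _ (by linarith [Real.cos_le_one (phase d k y)])
      refine le_trans ?_ (hlow y hy0)
      apply mul_le_mul_of_nonneg_left _ hc.le
      have hyn : 0 < ‖y‖ := norm_pos_iff.2 hy0
      have hyL : ‖y‖ ≤ L := by
        rw [Site.norm_eq_supNorm]; exact_mod_cast mem_box_iff_supNorm_le.1 hy
      exact Real.rpow_le_rpow_of_nonpos hyn hyL (by linarith)
  rw [← Finset.mul_sum] at hstep2
  have hstep3 := sum_box_one_sub_cos_ge hd hk hk0 hLge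
  -- assemble: `c L^{-(d+α)} L^d = c L^{-α} ≥ c (2π/‖k‖)^{-α}`
  have hLpow : c * (L : ℝ) ^ (-((d : ℝ) + α)) * (L : ℝ) ^ d = c * (L : ℝ) ^ (-α) := by
    rw [show -((d : ℝ) + α) = -α + -(d : ℝ) by ring, Real.rpow_add hLpos, Real.rpow_neg hLpos.le (d : ℝ),
      Real.rpow_natCast]
    field_simp
  have hkpow : (2 * π) ^ (-α) * ‖k‖ ^ α ≤ (L : ℝ) ^ (-α) := by
    have h1 : (L : ℝ) ^ (-α) ≥ (2 * π / ‖k‖) ^ (-α) :=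
      Real.rpow_le_rpow_of_nonpos hLpos hLle (by linarith)
    rw [Real.div_rpow (by positivity) hnk.le, Real.rpow_neg hnk.le, div_inv_eq_mul] at h1
    exact h1
  calc c * (2 * π) ^ (-α) * ‖k‖ ^ α = c * ((2 * π) ^ (-α) * ‖k‖ ^ α) := by ring
    _ ≤ c * (L : ℝ) ^ (-α) := mul_le_mul_of_nonneg_left hkpow hc.le
    _ = c * (L : ℝ) ^ (-((d : ℝ) + α)) * (L : ℝ) ^ d := hLpow.symm
    _ ≤ c * (L : ℝ) ^ (-((d : ℝ) + α)) * ∑ y ∈ box d L, (1 - Real.cos (phase d k y)) :=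
        mul_le_mul_of_nonneg_left hstep3 (by positivity)
    _ ≤ _ := hstep2.trans hstep1

end Psi

end Summit.CriticalPhenomena.Ising3DConformalLimit.Theorems.EtaBoundsTransfer
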